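import Literature.NumberTheory.GaloisRepresentations.LubinTateSeriesIndependence
import HarnessLib

/-!
# The canonical homomorphisms `[a]_{f,g} : F_g → F_f` of two Lubin–Tate series ON POINTS: additive, `[·]`-linear,
# mutually inverse for `a = 1`, natural under continuous coefficient-fixing maps (Lubin–Tate 1965 Thm. 1 — proofs only)

Topic `NumberTheory/GaloisRepresentations`; namespace `Literature.NumberTheory.GaloisRepresentations.LubinTate` (sequel of
`LubinTate.lean` §hom and of the points layer `LubinTatePoints.lean`; theorems only, no definition, no named fact, no instance).

For a Lubin–Tate datum `(A, π, q)` (`IsLTRing`) and two series `f, g ∈ 𝔉_π` (`IsLTSeries`), Lubin–Tate's Theorem 1 gives for every `a ∈ A`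
the unique `[a]_{f,g} ≡ aX` with `f ∘ [a]_{f,g} = [a]_{f,g} ∘ g` (tree `LubinTate.hom hA hf hg a`), a homomorphism `F_g → F_f`
(`ltF_subst_homX`), with `[a]_{f,g} ∘ [b]_{g,h} = [ab]_{f,h}` (`hom_comp_hom`) and `[1]_{f,f} = X` (`hom_one`).  The points layer evaluates
series at points of a closed nil ideal `M` of a complete linearly topologised `A`-algebra `S` (`evalPt₁`, `ltAdd`, `ltSMul`).  Here the
series identities are read ON POINTS (the proofs are those of `ltSMul_ltAdd` / `mul_ltSMul` of `LubinTatePoints`, with two series):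

* ★ `evalPt₁_hom_ltAdd` — **`[a]_{f,g}(x ⊕_g y) = [a]_{f,g}(x) ⊕_f [a]_{f,g}(y)`** (additivity);
* (already in the tree, used here: `evalPt₁_hom_evalPt₁_hom` — `[a]_{f,g}([b]_{g,h}(x)) = [ab]_{f,h}(x)` and `evalPt₁_zero`
  (`LubinTateSeriesIndependence`); `evalPt₁_hom_one_evalPt₁_hom_one` — `[1]_{f,g}([1]_{g,f}(x)) = x`, `ltSMul_evalPt₁_hom_one` —
  `A`-linearity, `eq_zero_of_evalPt₁_hom_one_eq_zero` (`CyclotomicCharacterArtinNormProofs`));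
* `bijective_evalPt₁_hom_one` — the canonical isomorphism `[1]_{f,g} : F_g(M) ≃ F_f(M)` IS a bijection on points;
  `evalPt₁_hom_eq_ltSMul_evalPt₁_hom_one` — `[a]_{f,g} = [a]_f ∘ [1]_{f,g}` on points; `evalPt₁_hom_one_eq_zero_iff` — `[1]_{f,g}(x) = 0 ↔ x = 0`;
  ★ `ltSMul_evalPt₁_hom_one_eq_zero_iff` — **`[b]_f([1]_{f,g} x) = 0 ↔ [b]_g x = 0`**: `[1]_{f,g}` carries the `b`-division points of `F_g`
  onto those of `F_f` (in particular the `πⁿ`-division points);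
* `algHom_evalPt₁_hom` — naturality: a continuous `A`-algebra map `ε : S → T` with `ε(M) ⊆ M'` commutes with `[a]_{f,g}` on points
  (`algHom_evalPt`), so `[1]_{f,g}` is equivariant for every Galois action through such maps.

Use (Cassels–Fröhlich VI §3.5 Prop. 1: "the formal `A`-modules `F_f`, `F_g` are canonically isomorphic by `[1]_{f,g}`"): transporting the
division points, the `A`-action and the Galois action from the Lubin–Tate group of an ARBITRARY `f ∈ 𝔉_π` (e.g. the endomorphism `[−p]` of the
formal group of a supersingular elliptic curve, `SupersingularFormalGroupLubinTateLocalField`) to the STANDARD group of `πX + X^q`, where the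
tree's torsion and character theory lives (`LubinTateTorsion`, `LubinTateCharacter(Limit)`).  No statement about number fields is proved here.

## References
* [LubinTate1965] J. Lubin, J. Tate, *Formal complex multiplication in local fields*, Ann. of Math. 81 (1965), §1 Thm. 1 (8)–(11)
  and the Corollary ("`F_f` and `F_g` are isomorphic over `A`").
* [CasselsFrohlichANT1967] J.-P. Serre, *Local class field theory* (Cassels–Fröhlich Ch. VI), §3.5 Prop. 1–3.
-/

noncomputable section

open MvPowerSeries

namespace Literature.NumberTheory.GaloisRepresentations

namespace LubinTate

section HomPoints

variable {A : Type*} [CommRing A] [UniformSpace A] [DiscreteUniformity A]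
variable {S : Type*} [CommRing S] [UniformSpace S] [IsUniformAddGroup S] [IsTopologicalRing S]
  [IsLinearTopology S S] [T2Space S] [CompleteSpace S] [Algebra A S] [ContinuousSMul A S]
variable (M : NilIdeal S) {π : A} {q : ℕ} (hA : IsLTRing π q) {f g h : PowerSeries A}
  (hf : IsLTSeries π q f) (hg : IsLTSeries π q g) (hh : IsLTSeries π q h)

/-- ★ **`[a]_{f,g}` is additive on points: `[a]_{f,g}(x ⊕_g y) = [a]_{f,g}(x) ⊕_f [a]_{f,g}(y)`** — Lubin–Tate's identity (8)
`F_f([a](X), [a](Y)) = [a](F_g(X, Y))` (`ltF_subst_homX`) evaluated at `(x, y)`. [cite: LubinTate1965, §1 Thm. 1 (8)] -/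
theorem evalPt₁_hom_ltAdd (a : A) (x y : M.toIdeal) :
    evalPt₁ M (hom hA hf hg a) (constantCoeff_hom hA hf hg a) (ltAdd M hA hg x y) =
      ltAdd M hA hf (evalPt₁ M (hom hA hf hg a) (constantCoeff_hom hA hf hg a) x)
        (evalPt₁ M (hom hA hf hg a) (constantCoeff_hom hA hf hg a) y) := by
  have key := ltF_subst_homX hA hf hg a
  have hXa : ∀ s : Fin 2, (homX hA hf hg a s : MvPowerSeries (Fin 2) A).constantCoeff = 0 :=
    fun s => constantCoeff_homX hA hf hg a s
  have ha2 : ∀ s : Fin 2,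
      ((![homX hA hf hg a (0 : Fin 2), homX hA hf hg a 1]) s).constantCoeff = 0 :=
    fun s => by fin_cases s <;> exact hXa _
  have hL := evalPt_subst M ha2 (ltF hA hf) (constantCoeff_ltF hA hf)
    (constantCoeff_subst_zero ha2 (constantCoeff_ltF hA hf)) ![x, y]
  have hR := evalPt₁_subst M (ltF hA hg) (constantCoeff_ltF hA hg) (hom hA hf hg a)
    (constantCoeff_hom hA hf hg a) (by
      rw [← key]; exact constantCoeff_subst_zero ha2 (constantCoeff_ltF hA hf)) ![x, y]
  have e := evalPt_congr M key (constantCoeff_subst_zero ha2 (constantCoeff_ltF hA hf))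
    (by rw [← key]; exact constantCoeff_subst_zero ha2 (constantCoeff_ltF hA hf)) ![x, y]
  rw [hL, hR] at e
  have hs : ∀ s : Fin 2, evalPt M (homX hA hf hg a s) (hXa s) ![x, y] =
      evalPt₁ M (hom hA hf hg a) (constantCoeff_hom hA hf hg a) (![x, y] s) := fun s => by
    rw [evalPt_congr M (show homX hA hf hg a s =
        PowerSeries.subst (X s : MvPowerSeries (Fin 2) A) (hom hA hf hg a) from rfl) (hXa s)
        (hXa s),
      evalPt₁_subst M (X s : MvPowerSeries (Fin 2) A) (constantCoeff_X s) (hom hA hf hg a)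
        (constantCoeff_hom hA hf hg a) (hXa s) ![x, y], evalPt_X]
  symm
  convert e using 2
  · change evalPt M (ltF hA hf) (constantCoeff_ltF hA hf) ![_, _] = _
    congr 1
    funext s
    fin_cases s
    · exact (hs 0).symm
    · exact (hs 1).symm
  · rfl

/-- ★ **The canonical isomorphism on points**: `x ↦ [1]_{f,g}(x)` is a bijection `F_g(M) → F_f(M)` (inverse `[1]_{g,f}`).
[cite: CasselsFrohlichANT1967, Ch. VI §3.5 Prop. 1] [cite: LubinTate1965, §1 Cor. to Thm. 1] -/
theorem bijective_evalPt₁_hom_one :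
    Function.Bijective (evalPt₁ M (hom hA hf hg 1) (constantCoeff_hom hA hf hg 1)) :=
  Function.bijective_iff_has_inverse.mpr ⟨evalPt₁ M (hom hA hg hf 1) (constantCoeff_hom hA hg hf 1),
    fun x => evalPt₁_hom_one_evalPt₁_hom_one M hA hg hf x, fun x => evalPt₁_hom_one_evalPt₁_hom_one M hA hf hg x⟩

/-- **`[1]_{f,g}` is `A`-linear for the two module structures: `[1]_{f,g}([a]_g x) = [a]_f([1]_{f,g} x)`** — the tree's
`ltSMul_evalPt₁_hom_one` read from the other side. [cite: LubinTate1965, §1 Thm. 1 (9)] [cite: CasselsFrohlichANT1967, Ch. VI §3.5 Prop. 1] -/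
theorem evalPt₁_hom_one_ltSMul (a : A) (x : M.toIdeal) :
    evalPt₁ M (hom hA hf hg 1) (constantCoeff_hom hA hf hg 1) (ltSMul M hA hg a x) =
      ltSMul M hA hf a (evalPt₁ M (hom hA hf hg 1) (constantCoeff_hom hA hf hg 1) x) :=
  (ltSMul_evalPt₁_hom_one M hA hg hf a x).symm

/-- `[a]_{f,g}(x) = [a]_f([1]_{f,g} x)`: every `[a]_{f,g}` factors through the canonical isomorphism. [cite: LubinTate1965, §1 Thm. 1 (9)] -/
theorem evalPt₁_hom_eq_ltSMul_evalPt₁_hom_one (a : A) (x : M.toIdeal) :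
    evalPt₁ M (hom hA hf hg a) (constantCoeff_hom hA hf hg a) x =
      ltSMul M hA hf a (evalPt₁ M (hom hA hf hg 1) (constantCoeff_hom hA hf hg 1) x) := by
  unfold ltSMul
  rw [evalPt₁_hom_evalPt₁_hom M hA hf hf hg a 1 x, mul_one]

/-- `[1]_{f,g}(x) = 0 ↔ x = 0`. [cite: CasselsFrohlichANT1967, Ch. VI §3.5 Prop. 1] -/
theorem evalPt₁_hom_one_eq_zero_iff (x : M.toIdeal) :
    evalPt₁ M (hom hA hf hg 1) (constantCoeff_hom hA hf hg 1) x = 0 ↔ x = 0 := by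
  refine ⟨fun hx => eq_zero_of_evalPt₁_hom_one_eq_zero M hA hg hf hx, fun hx => by rw [hx, evalPt₁_zero]⟩

/-- ★ **`[1]_{f,g}` matches division points: `[b]_f([1]_{f,g} x) = 0 ↔ [b]_g x = 0`** — in particular the `πⁿ`-division points of `F_g`
are carried bijectively onto those of `F_f`. [cite: CasselsFrohlichANT1967, Ch. VI §3.5 Prop. 1] [cite: LubinTate1965, §1 Thm. 1 (9)] -/
theorem ltSMul_evalPt₁_hom_one_eq_zero_iff (b : A) (x : M.toIdeal) :
    ltSMul M hA hf b (evalPt₁ M (hom hA hf hg 1) (constantCoeff_hom hA hf hg 1) x) = 0 ↔ ltSMul M hA hg b x = 0 := by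
  rw [← evalPt₁_hom_one_ltSMul, evalPt₁_hom_one_eq_zero_iff]

variable {T : Type*} [CommRing T] [UniformSpace T] [IsUniformAddGroup T] [IsTopologicalRing T]
  [IsLinearTopology T T] [T2Space T] [CompleteSpace T] [Algebra A T] [ContinuousSMul A T]
  (M' : NilIdeal T)

/-- **Naturality**: a continuous `A`-algebra map `ε : S → T` with `ε x = x'` satisfies `ε([a]_{f,g} x) = [a]_{f,g} x'` — so `[1]_{f,g}` is
equivariant for any group acting on the points through such maps (e.g. a Galois group fixing the coefficients; Lubin–Tate's
"`[u]_f` commutes with the operation of `τ`" in the proof of Thm. 2). [cite: LubinTate1965, §2 proof of Thm. 2] -/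
theorem algHom_evalPt₁_hom (ε : S →ₐ[A] T) (hε : Continuous ε) (a : A) (x : M.toIdeal) (x' : M'.toIdeal)
    (hx : ε x = x') :
    ε (evalPt₁ M (hom hA hf hg a) (constantCoeff_hom hA hf hg a) x) =
      evalPt₁ M' (hom hA hf hg a) (constantCoeff_hom hA hf hg a) x' := by
  unfold evalPt₁
  exact algHom_evalPt M M' ε hε _ _ _ _ fun _ => hx

end HomPoints

end LubinTate

end Literature.NumberTheory.GaloisRepresentations

end
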